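import Literature.MathematicalPhysics.QuantumLattice.GrassmannEffectiveActionGradedZoneLipschitzDB
import Literature.MathematicalPhysics.QuantumLattice.GrassmannSupportSplit
import HarnessLib

/-!
# Interaction differences that are SMALL AT DEEP PINS and arbitrary near a zone: the GRADED increments agree at deeper pins (telescoped product form)

Topic `MathematicalPhysics/QuantumLattice`; the GRADED twin of `GrassmannDeepPinLipschitz` (which does the same in the flat `‖·‖_h` currency).  Assembles
`GrassmannSupportSplit` (split `D = D_small + D_big` by the support of the monomials: all legs deep / some leg in the zone),
`GrassmannEffectiveActionGradedLipschitzDB` (the zone-free graded telescoped Lipschitz bound, for `D_small`, whose UNWEIGHTED profile is globally small) and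
`GrassmannEffectiveActionGradedZoneLipschitzDB` (the graded zone bound against an admissible constant, for `D_big`, which touches the zone and has only a
WEIGHTED profile of the size of the actions themselves).  This is the interaction bracket of one block of the nested two-volume comparison of effective
actions in the currency of a graded (Lipschitz) multiscale bookkeeping (Benfatto–Giuliani–Mastropietro 2006, (2.13)–(2.14), (2.61)–(2.63), (2.86)–(2.90) with
§3; Gawȩdzki–Kupiainen 1985 §3): the fine previous action `V + D` and the glued coarse one `V` differ by `D`, whose unweighted pinned profile is `≤ E` at the
pins of the deep region `P` and whose `wt`-weighted profile is `≤ N_D` everywhere; at a pin `w` with `Λ ≤ wt S` for every `S ∋ w` meeting `Pᶜ`: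

* **`sum_norm_kernel_incr_sub_incr_le_graded_of_deep`** — with `incr_C X := effAction C X − e^{Δ_C} X`,
  `Σ_{X : X_i = w} ‖kernel_m (incr_C (V + D) − incr_C V)(X)‖ ≤ GL(μ₁ := N_V + N_D + E; ν := E) + Λ⁻¹ · GZ_Λ(μ₂ := N_V + N_D; ν := N_D)`,
  where `GL` is the right side of `sum_norm_kernel_effAction_sub_gaussConv_sub_le_graded_of_gramBounded` (telescoped graded sum + `2·`tail) and `GZ_Λ` that of
  `const_mul_sum_norm_kernel_effAction_sub_gaussConv_sub_le_graded_zone_of_gramBounded` (telescoped graded sum + `Λ·2·`tail) — both in the PRODUCT form on the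
  leg constraint that a graded tower consumes (kit readings: `…EngineTowerDoorToKitLip`, `…TwoVolumeLipDoorToKit`).

Everything is proved; no definition, no named fact.

## Sources

G. Benfatto, A. Giuliani, V. Mastropietro, Ann. Henri Poincaré 7 (2006) 809–898, (2.13)–(2.14), (2.61)–(2.63), (2.86)–(2.90), §3 (3.2)–(3.8)
[`BenfattoGiulianiMastropietro2006`]; K. Gawȩdzki, A. Kupiainen, Comm. Math. Phys. 102 (1985) 1–30, §3 [`GawedzkiKupiainen1985GrossNeveu`].
-/

noncomputable section

namespace Literature.MathematicalPhysics.QuantumLattice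

open GrassmannAlgebra Finset Literature.Probability.LatticeModels Literature.Probability.LatticeModels.BattleFederbush
open scoped Nat

universe u

variable {𝕜 : Type*} [RCLike 𝕜] {Γ : Type u} [Fintype Γ] [DecidableEq Γ] {wt : Finset Γ → ℝ} (C : Matrix Γ Γ 𝕜)

/-- **DIFFERENCE SMALL AT DEEP PINS, ARBITRARY NEAR THE ZONE ⇒ GRADED INCREMENTS CLOSE AT DEEPER PINS** (telescoped product form).  Replica-Gram-bounded `C`
(constant `κ`) with `wt`-weighted row/column sums `≤ α` for a tree weight `wt`; even `V`, `D` without constant part; `wt`-weighted pinned profiles `N_V`, `N_D`;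
the UNWEIGHTED pinned profile of `D` at every pin of the deep region `P` at most `E`; two smallness conditions (`θ₁` at the majorant `N_V + N_D + E`, `θ₂` at
`N_V + N_D`); `0 < Λ ≤ wt S` for every `S ∋ w` meeting `Pᶜ`.  Then for every `N₀ ≥ 2` and every degree `m ≥ 1`,
`Σ_{X : X_i = w} ‖kernel_m ((effAction C (V+D) − e^{Δ_C}(V+D)) − (effAction C V − e^{Δ_C}V))(X)‖ ≤ GL(N_V+N_D+E; E) + Λ⁻¹·GZ_Λ(N_V+N_D; N_D)`.
[cite: BenfattoGiulianiMastropietro2006, (2.13)-(2.14) and (2.86)-(2.90)] -/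
theorem sum_norm_kernel_incr_sub_incr_le_graded_of_deep (hwt : IsTreeWeight wt) {κ : ℝ} (hκ : 0 < κ) (hGB : IsGramBoundedR C κ)
    (V D : GrassmannAlgebra 𝕜 Γ) (hV : V ∈ evenPart 𝕜 Γ) (hD : D ∈ evenPart 𝕜 Γ) (hV0 : constPart 𝕜 V = 0) (hD0 : constPart 𝕜 D = 0)
    (NV ND E : ℕ → ℝ) (hNV0 : ∀ m', 0 ≤ NV m') (hND0 : ∀ m', 0 ≤ ND m') (hE0 : ∀ m', 0 ≤ E m')
    (hNV : ∀ m' (j : Fin (2 * m')) (x : Γ), ∑ Y ∈ univ.filter (fun Y : Fin (2 * m') → Γ => Y j = x),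
      ‖kernel 𝕜 V (2 * m') Y‖ * wt (univ.image Y) ≤ NV m')
    (hND : ∀ m' (j : Fin (2 * m')) (x : Γ), ∑ Y ∈ univ.filter (fun Y : Fin (2 * m') → Γ => Y j = x),
      ‖kernel 𝕜 D (2 * m') Y‖ * wt (univ.image Y) ≤ ND m')
    (P : Γ → Prop) [DecidablePred P]
    (hE : ∀ m' (j : Fin (2 * m')) (x : Γ), P x → ∑ Y ∈ univ.filter (fun Y : Fin (2 * m') → Γ => Y j = x), ‖kernel 𝕜 D (2 * m') Y‖ ≤ E m')
    {α : ℝ} (hα : 0 < α) (hrow : ∀ X, ∑ Y, ‖C X Y‖ * wt {X, Y} ≤ α) (hcol : ∀ Y, ∑ X, ‖C X Y‖ * wt {X, Y} ≤ α)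
    {ρ : ℝ} (hρ : 0 < ρ)
    (hθ₁ : Real.exp 1 * α * normV Γ κ ρ (fun m' => NV m' + ND m' + E m') / κ ^ 2 < 1)
    (hθ₂ : Real.exp 1 * α * normV Γ κ ρ (fun m' => NV m' + ND m') / κ ^ 2 < 1)
    {N₀ : ℕ} (hN₀ : 2 ≤ N₀) {m : ℕ} (hm : 0 < m) (i : Fin m) (w : Γ)
    {Λ : ℝ} (hΛ0 : 0 < Λ) (hΛ : ∀ S : Finset Γ, w ∈ S → (∃ z ∈ S, ¬ P z) → Λ ≤ wt S) :
    ∑ X ∈ univ.filter (fun X : Fin m → Γ => X i = w),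
        ‖kernel 𝕜 ((effAction 𝕜 C (V + D) - gaussConv 𝕜 C (V + D)) - (effAction 𝕜 C V - gaussConv 𝕜 C V)) m X‖ ≤
      (∑ n ∈ Ico 2 N₀, (ρ⁻¹ ^ m * κ⁻¹ ^ (2 * (n - 1)) * (α ^ (n - 1) * Real.exp n)) *
          ∑ δ ∈ (Fintype.piFinset fun _ : Fin n => range (Fintype.card Γ / 2 + 1)) with m + 2 * (n - 1) ≤ ∑ a, 2 * δ a,
            ∑ a, (Real.exp 2 * (κ + ρ)) ^ (2 * δ a) * E (δ a) *
              ∏ b ∈ univ.erase a, (Real.exp 2 * (κ + ρ)) ^ (2 * δ b) * (NV (δ b) + ND (δ b) + E (δ b)) +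
        2 * (ρ⁻¹ ^ m * (Real.exp 1 * normV Γ κ ρ (fun m' => NV m' + ND m' + E m')) *
          (Real.exp 1 * α * normV Γ κ ρ (fun m' => NV m' + ND m' + E m') / κ ^ 2) ^ (N₀ - 1) /
            (1 - Real.exp 1 * α * normV Γ κ ρ (fun m' => NV m' + ND m' + E m') / κ ^ 2))) +
      Λ⁻¹ * (∑ n ∈ Ico 2 N₀, (ρ⁻¹ ^ m * κ⁻¹ ^ (2 * (n - 1)) * (α ^ (n - 1) * Real.exp n)) *
          ∑ δ ∈ (Fintype.piFinset fun _ : Fin n => range (Fintype.card Γ / 2 + 1)) with m + 2 * (n - 1) ≤ ∑ a, 2 * δ a,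
            ∑ a, (Real.exp 2 * (κ + ρ)) ^ (2 * δ a) * ND (δ a) *
              ∏ b ∈ univ.erase a, (Real.exp 2 * (κ + ρ)) ^ (2 * δ b) * (NV (δ b) + ND (δ b)) +
        Λ * (2 * (ρ⁻¹ ^ m * (Real.exp 1 * normV Γ κ ρ (fun m' => NV m' + ND m')) *
          (Real.exp 1 * α * normV Γ κ ρ (fun m' => NV m' + ND m') / κ ^ 2) ^ (N₀ - 1) /
            (1 - Real.exp 1 * α * normV Γ κ ρ (fun m' => NV m' + ND m') / κ ^ 2)))) := by
  -- the support split `D = Ds + Db`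
  set Ds : GrassmannAlgebra 𝕜 Γ := supportPart 𝕜 P D with hDs
  set Db : GrassmannAlgebra 𝕜 Γ := D - supportPart 𝕜 P D with hDb
  have hsplit : V + D = V + Db + Ds := by rw [hDb, hDs]; abel
  have hDs_even : Ds ∈ evenPart 𝕜 Γ := supportPart_mem_evenPart 𝕜 P hD
  have hDb_even : Db ∈ evenPart 𝕜 Γ := sub_mem hD hDs_even
  have hDs0 : constPart 𝕜 Ds = 0 := by rw [hDs, constPart_supportPart, hD0]
  have hDb0 : constPart 𝕜 Db = 0 := by rw [hDb, map_sub, constPart_supportPart, hD0, sub_zero]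
  have hVDb_even : V + Db ∈ evenPart 𝕜 Γ := add_mem hV hDb_even
  have hVDb0 : constPart 𝕜 (V + Db) = 0 := by rw [map_add, hV0, hDb0, add_zero]
  have hVD_even : V + Db + Ds ∈ evenPart 𝕜 Γ := add_mem hVDb_even hDs_even
  have hVD0 : constPart 𝕜 (V + Db + Ds) = 0 := by rw [map_add, hVDb0, hDs0, add_zero]
  -- unweighted data (`1 ≤ wt`)
  have hrowu : ∀ X, ∑ Y, ‖C X Y‖ ≤ α := fun X =>
    (sum_le_sum fun Y _ => le_mul_of_one_le_right (norm_nonneg _) (hwt.one_le _)).trans (hrow X)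
  have hcolu : ∀ Y, ∑ X, ‖C X Y‖ ≤ α := fun Y =>
    (sum_le_sum fun X _ => le_mul_of_one_le_right (norm_nonneg _) (hwt.one_le _)).trans (hcol Y)
  -- profiles of the pieces
  have hDs_prof : ∀ m' (j : Fin (2 * m')) (x : Γ), ∑ Y ∈ univ.filter (fun Y : Fin (2 * m') → Γ => Y j = x), ‖kernel 𝕜 Ds (2 * m') Y‖ ≤ E m' := by
    intro m' j x
    have hle := sum_filter_norm_kernel_supportPart_mul_le P D (2 * m') j x (fun _ => (1 : ℝ)) (fun _ => zero_le_one)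
    simp only [mul_one] at hle
    rw [← hDs] at hle
    by_cases hx : P x
    · exact hle.trans (hE m' j x hx)
    · have hze := sum_filter_norm_kernel_supportPart_eq_zero_of_not P D (2 * m') j hx (fun _ => (1 : ℝ))
      simp only [mul_one] at hze
      rw [← hDs] at hze
      rw [hze]
      exact hE0 m'
  have hDb_wprof : ∀ m' (j : Fin (2 * m')) (x : Γ), ∑ Y ∈ univ.filter (fun Y : Fin (2 * m') → Γ => Y j = x),
      ‖kernel 𝕜 Db (2 * m') Y‖ * wt (univ.image Y) ≤ ND m' := by
    intro m' j x
    have h := (sum_filter_norm_kernel_sub_supportPart_mul_le P D (2 * m') j x (fun Y => wt (univ.image Y)) fun Y => hwt.nonneg _).trans (hND m' j x)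
    rw [← hDb] at h
    exact h
  -- unweighted profiles: `V + Db ≤ N_V + N_D ≤ N_V + N_D + E`, `V + Db + Ds ≤ N_V + N_D + E`
  have hVDb_prof : ∀ m' (j : Fin (2 * m')) (x : Γ), ∑ Y ∈ univ.filter (fun Y : Fin (2 * m') → Γ => Y j = x),
      ‖kernel 𝕜 (V + Db) (2 * m') Y‖ ≤ NV m' + ND m' := by
    intro m' j x
    calc ∑ Y ∈ univ.filter (fun Y : Fin (2 * m') → Γ => Y j = x), ‖kernel 𝕜 (V + Db) (2 * m') Y‖
        ≤ ∑ Y ∈ univ.filter (fun Y : Fin (2 * m') → Γ => Y j = x),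
            (‖kernel 𝕜 V (2 * m') Y‖ * wt (univ.image Y) + ‖kernel 𝕜 Db (2 * m') Y‖ * wt (univ.image Y)) := by
          refine sum_le_sum fun Y _ => ?_
          rw [kernel_add]
          refine (norm_add_le _ _).trans (add_le_add ?_ ?_) <;> exact le_mul_of_one_le_right (norm_nonneg _) (hwt.one_le _)
      _ ≤ NV m' + ND m' := by rw [sum_add_distrib]; exact add_le_add (hNV m' j x) (hDb_wprof m' j x)
  have hVDb_prof' : ∀ m' (j : Fin (2 * m')) (x : Γ), ∑ Y ∈ univ.filter (fun Y : Fin (2 * m') → Γ => Y j = x),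
      ‖kernel 𝕜 (V + Db) (2 * m') Y‖ ≤ (fun m' => NV m' + ND m' + E m') m' :=
    fun m' j x => (hVDb_prof m' j x).trans (by have := hE0 m'; simp only; linarith)
  have hVD_prof : ∀ m' (j : Fin (2 * m')) (x : Γ), ∑ Y ∈ univ.filter (fun Y : Fin (2 * m') → Γ => Y j = x),
      ‖kernel 𝕜 (V + Db + Ds) (2 * m') Y‖ ≤ (fun m' => NV m' + ND m' + E m') m' := by
    intro m' j x
    calc ∑ Y ∈ univ.filter (fun Y : Fin (2 * m') → Γ => Y j = x), ‖kernel 𝕜 (V + Db + Ds) (2 * m') Y‖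
        ≤ ∑ Y ∈ univ.filter (fun Y : Fin (2 * m') → Γ => Y j = x), (‖kernel 𝕜 (V + Db) (2 * m') Y‖ + ‖kernel 𝕜 Ds (2 * m') Y‖) :=
          sum_le_sum fun Y _ => by rw [kernel_add]; exact norm_add_le _ _
      _ ≤ NV m' + ND m' + E m' := by rw [sum_add_distrib]; exact add_le_add (hVDb_prof m' j x) (hDs_prof m' j x)
  have hdiff₁ : ∀ m' (j : Fin (2 * m')) (x : Γ), ∑ Y ∈ univ.filter (fun Y : Fin (2 * m') → Γ => Y j = x),
      ‖kernel 𝕜 (V + Db + Ds) (2 * m') Y - kernel 𝕜 (V + Db) (2 * m') Y‖ ≤ E m' := by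
    intro m' j x
    refine le_trans (le_of_eq (sum_congr rfl fun Y _ => ?_)) (hDs_prof m' j x)
    rw [kernel_add, add_sub_cancel_left]
  -- weighted profiles for the zone bracket: `V ≤ N_V + N_D`, `V + Db ≤ N_V + N_D`, difference `Db ≤ N_D`
  have hV_wprof' : ∀ m' (j : Fin (2 * m')) (x : Γ), ∑ Y ∈ univ.filter (fun Y : Fin (2 * m') → Γ => Y j = x),
      ‖kernel 𝕜 V (2 * m') Y‖ * wt (univ.image Y) ≤ (fun m' => NV m' + ND m') m' :=
    fun m' j x => (hNV m' j x).trans (by have := hND0 m'; simp only; linarith)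
  have hVDb_wprof : ∀ m' (j : Fin (2 * m')) (x : Γ), ∑ Y ∈ univ.filter (fun Y : Fin (2 * m') → Γ => Y j = x),
      ‖kernel 𝕜 (V + Db) (2 * m') Y‖ * wt (univ.image Y) ≤ (fun m' => NV m' + ND m') m' := by
    intro m' j x
    calc ∑ Y ∈ univ.filter (fun Y : Fin (2 * m') → Γ => Y j = x), ‖kernel 𝕜 (V + Db) (2 * m') Y‖ * wt (univ.image Y)
        ≤ ∑ Y ∈ univ.filter (fun Y : Fin (2 * m') → Γ => Y j = x),
            (‖kernel 𝕜 V (2 * m') Y‖ * wt (univ.image Y) + ‖kernel 𝕜 Db (2 * m') Y‖ * wt (univ.image Y)) := by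
          refine sum_le_sum fun Y _ => ?_
          rw [kernel_add, ← add_mul]
          exact mul_le_mul_of_nonneg_right (norm_add_le _ _) (hwt.nonneg _)
      _ ≤ NV m' + ND m' := by rw [sum_add_distrib]; exact add_le_add (hNV m' j x) (hDb_wprof m' j x)
  have hdiff₂ : ∀ m' (j : Fin (2 * m')) (x : Γ), ∑ Y ∈ univ.filter (fun Y : Fin (2 * m') → Γ => Y j = x),
      ‖kernel 𝕜 (V + Db) (2 * m') Y - kernel 𝕜 V (2 * m') Y‖ * wt (univ.image Y) ≤ ND m' := by
    intro m' j x
    refine le_trans (le_of_eq (sum_congr rfl fun Y _ => ?_)) (hDb_wprof m' j x)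
    rw [kernel_add, add_sub_cancel_left]
  -- the zone hypothesis for `Db`
  have hZ : ∀ (m' : ℕ) (Y : Fin (2 * m') → Γ), kernel 𝕜 (V + Db) (2 * m') Y ≠ kernel 𝕜 V (2 * m') Y → ∃ j, Y j ∈ {z | ¬ P z} := by
    intro m' Y h
    have h' : kernel 𝕜 Db (2 * m') Y ≠ 0 := by
      intro h0; apply h; rw [kernel_add, h0, add_zero]
    exact exists_not_of_kernel_sub_supportPart_ne_zero 𝕜 P D h'
  have hΛ' : ∀ S : Finset Γ, w ∈ S → (∃ z ∈ S, z ∈ {z | ¬ P z}) → Λ ≤ wt S := fun S hS hz => hΛ S hS hz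
  -- (1) the small part: zone-free graded Lipschitz bound
  have hsmall := sum_norm_kernel_effAction_sub_gaussConv_sub_le_graded_of_gramBounded C hκ hGB (V + Db + Ds) (V + Db) hVD_even hVDb_even hVD0 hVDb0
    (fun m' => NV m' + ND m' + E m') E (fun m' => add_nonneg (add_nonneg (hNV0 m') (hND0 m')) (hE0 m')) hE0 hVD_prof hVDb_prof' hdiff₁ hα hrowu
    hcolu hρ hθ₁ hN₀ hm i w
  -- (2) the big part: graded zone bound, divided by `Λ`
  have hbig' := const_mul_sum_norm_kernel_effAction_sub_gaussConv_sub_le_graded_zone_of_gramBounded C hwt hκ hGB (V + Db) V hVDb_even hV hVDb0 hV0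
    (fun m' => NV m' + ND m') ND (fun m' => add_nonneg (hNV0 m') (hND0 m')) hND0 hVDb_wprof hV_wprof' hdiff₂ hα hrow hcol hρ hθ₂ hN₀ hm i w
    {z | ¬ P z} hZ hΛ0.le hΛ'
  have hbig := (le_inv_mul_iff₀ hΛ0).2 hbig'
  -- assemble
  have halg : (effAction 𝕜 C (V + D) - gaussConv 𝕜 C (V + D)) - (effAction 𝕜 C V - gaussConv 𝕜 C V) =
      ((effAction 𝕜 C (V + Db + Ds) - gaussConv 𝕜 C (V + Db + Ds)) - (effAction 𝕜 C (V + Db) - gaussConv 𝕜 C (V + Db))) +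
        ((effAction 𝕜 C (V + Db) - gaussConv 𝕜 C (V + Db)) - (effAction 𝕜 C V - gaussConv 𝕜 C V)) := by
    rw [hsplit]; abel
  calc ∑ X ∈ univ.filter (fun X : Fin m → Γ => X i = w),
        ‖kernel 𝕜 ((effAction 𝕜 C (V + D) - gaussConv 𝕜 C (V + D)) - (effAction 𝕜 C V - gaussConv 𝕜 C V)) m X‖
      ≤ ∑ X ∈ univ.filter (fun X : Fin m → Γ => X i = w),
          (‖kernel 𝕜 ((effAction 𝕜 C (V + Db + Ds) - gaussConv 𝕜 C (V + Db + Ds)) -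
              (effAction 𝕜 C (V + Db) - gaussConv 𝕜 C (V + Db))) m X‖ +
            ‖kernel 𝕜 ((effAction 𝕜 C (V + Db) - gaussConv 𝕜 C (V + Db)) - (effAction 𝕜 C V - gaussConv 𝕜 C V)) m X‖) := by
        refine sum_le_sum fun X _ => ?_
        rw [halg, kernel_add]
        exact norm_add_le _ _
    _ ≤ _ := by rw [sum_add_distrib]; exact add_le_add hsmall hbig

end Literature.MathematicalPhysics.QuantumLattice

end
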